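import Summits.HodgeConjecture.CorCM.Census.QuarticInversionNormalForm
import Summits.HodgeConjecture.CorCM.Census.QuarticInversionClosingM

/-!
# The quartic inversion twists, XVI: the orbit span of a family, its value module, and the two sources of binomials

COR-CM (cell `pub-hodgecm2`, stage 2 of the Hodge ladder), count-neutral KERNEL COMBINATORICS by the binder seat b23 (gen 44; claim
QUARTIC-INVERSION, HOME/INBOX.md l.12829).  Part XVI of the lane `Census/QuarticInversion*`, on top of parts I–XV, all BY NAME.  Bookkeeping
definitions with bodies (`orbSpan`, `valMod`) + theorems; no `Prop`-valued definition, no `decide` beyond closed identities in `Bool`/`Fin 4`, no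
certificate, no named fact, no geometry, no `sorry`.  `Interfaces.lean` (C1), every E term, B01, `Transposition/*`, `PortJoin/*` untouched.
HONEST FRAMING: `HC_CM` is NOT proved, here or anywhere in the tree; nothing here is a period, a count of record or a headline.

CONTENT (`|B|` odd `≥ 3`, square class `ζ`).
* §1 **The orbit span** `orbSpan ζ F` of a family `F ⊆ ℤ[Ty₄]`: the least submodule containing `F` and stable under the motions `translH₄ g`,
  `translY ζ`, `translT` (the span of the `G_ζ(B)`-translates of `F`); it lies in `hodge₄` when `F` does.  **The value module**
  `valMod ζ F = Avec (orbSpan ζ F) ⊆ ℤ^Idx`.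
* §2 **Moving binomials inside the value module**: if `binVec j h h' u ∈ valMod` then so is the binomial at every other slot, and the binomials
  moved by `y` and by `t` (part XIV's transport); chains (`memT`), reversal (`memS`), and the free flips at the own coordinate (`memJ`).
* §3 **The two sources**: the value vector of a mixed closing face IS a slot binomial (`Avec_mixFace`, so `mix_mem`), and the value vector of
  `S_b − (0,σ)·S_{!b}` is the antipodal slot binomial `binVec 0 (!b) b s₀` whenever `(P⁺, σ, s₀)` is a **cross datum**:
  `s₀ ∈ P⁺` and `s + σ ∈ P⁺ ↔ (s ∉ P⁺ ∨ s = s₀)` (`cross_mem`; in `ℤ/(2K+1)`: `P⁺ = {0,…,K}`, `σ = K`, `s₀ = 0`).  All [folklore].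

## References
* [Pohlmann1968] H. Pohlmann, Algebraic cycles on abelian varieties of complex multiplication type, Ann. of Math. 88 (1968), Thm 1.
-/

namespace Summit.HodgeConjecture.CorCM.Census.QuarticInversion

open Finset
open Summit.HodgeConjecture.CorCM.Census.OddSliceFacesModel

noncomputable section

variable (A : Type) [AddCommGroup A] [Fintype A] [DecidableEq A] (ζ : ZMod 2)

/-! ## §1 The orbit span and the value module -/

/-- **The orbit span of `F`**: the least submodule containing `F` and stable under `translH₄ g`, `translY ζ`, `translT`. [folklore] -/
def orbSpan (F : Set (Ty₄ A → ℤ)) : Submodule ℤ (Ty₄ A → ℤ) :=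
  sInf {N | F ⊆ N ∧ (∀ g : ZMod 2 × A, ∀ v ∈ N, translH₄ A g v ∈ N) ∧ (∀ v ∈ N, translY A ζ v ∈ N) ∧ (∀ v ∈ N, translT A v ∈ N)}

omit [Fintype A] [DecidableEq A] in
/-- `F ⊆ orbSpan F`. [folklore] -/
theorem subset_orbSpan (F : Set (Ty₄ A → ℤ)) {f : Ty₄ A → ℤ} (hf : f ∈ F) : f ∈ orbSpan A ζ F := by
  rw [orbSpan, Submodule.mem_sInf]
  intro N hN
  exact hN.1 hf

omit [Fintype A] [DecidableEq A] in
/-- The orbit span is stable under `H₀`. [folklore] -/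
theorem translH₄_mem_orbSpan (F : Set (Ty₄ A → ℤ)) (g : ZMod 2 × A) {v : Ty₄ A → ℤ} (hv : v ∈ orbSpan A ζ F) :
    translH₄ A g v ∈ orbSpan A ζ F := by
  rw [orbSpan, Submodule.mem_sInf] at hv ⊢
  intro N hN
  exact hN.2.1 g v (hv N hN)

omit [Fintype A] [DecidableEq A] in
/-- The orbit span is stable under `y`. [folklore] -/
theorem translY_mem_orbSpan (F : Set (Ty₄ A → ℤ)) {v : Ty₄ A → ℤ} (hv : v ∈ orbSpan A ζ F) : translY A ζ v ∈ orbSpan A ζ F := by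
  rw [orbSpan, Submodule.mem_sInf] at hv ⊢
  intro N hN
  exact hN.2.2.1 v (hv N hN)

omit [Fintype A] [DecidableEq A] in
/-- The orbit span is stable under `t`. [folklore] -/
theorem translT_mem_orbSpan (F : Set (Ty₄ A → ℤ)) {v : Ty₄ A → ℤ} (hv : v ∈ orbSpan A ζ F) : translT A v ∈ orbSpan A ζ F := by
  rw [orbSpan, Submodule.mem_sInf] at hv ⊢
  intro N hN
  exact hN.2.2.2 v (hv N hN)

omit [Fintype A] [DecidableEq A] in
/-- **Induction**: a stable submodule containing `F` contains the orbit span. [folklore] -/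
theorem orbSpan_le {F : Set (Ty₄ A → ℤ)} {N : Submodule ℤ (Ty₄ A → ℤ)} (hF : F ⊆ N) (hH : ∀ g : ZMod 2 × A, ∀ v ∈ N, translH₄ A g v ∈ N)
    (hY : ∀ v ∈ N, translY A ζ v ∈ N) (hT : ∀ v ∈ N, translT A v ∈ N) : orbSpan A ζ F ≤ N :=
  sInf_le ⟨hF, hH, hY, hT⟩

/-- The orbit span of a family of Hodge vectors lies in `hodge₄`. [folklore] -/
theorem orbSpan_le_hodge₄ {F : Set (Ty₄ A → ℤ)} (hF : F ⊆ hodge₄ A) : orbSpan A ζ F ≤ hodge₄ A :=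
  orbSpan_le A ζ hF (fun g _ hv => translH₄_mem A hv g) (fun _ hv => translY_mem A ζ hv) (fun _ hv => translT_mem A hv)

/-- **The value module** of `F`: the value vectors of the orbit span. [folklore] -/
def valMod (F : Set (Ty₄ A → ℤ)) : Submodule ℤ (Idx A → ℤ) := (orbSpan A ζ F).map (Avec A)

/-- Value vectors of members of the orbit span lie in the value module. [folklore] -/
theorem Avec_mem_valMod (F : Set (Ty₄ A → ℤ)) {v : Ty₄ A → ℤ} (hv : v ∈ orbSpan A ζ F) : Avec A v ∈ valMod A ζ F :=
  Submodule.mem_map_of_mem hv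

/-! ## §2 Moving binomials inside the value module -/

variable {ζ}

/-- **Every slot**: a binomial in the value module is there at every slot. [folklore] -/
theorem slot_mem (hA : Odd (Fintype.card A)) {F : Set (Ty₄ A → ℤ)} {j : Fin 4} {h h' : Fin 4 → Bool} {u : A}
    (H : binVec A j h h' u ∈ valMod A ζ F) (u' : A) : binVec A j h h' u' ∈ valMod A ζ F := by
  obtain ⟨c, hc, e⟩ := Submodule.mem_map.mp H
  refine Submodule.mem_map.mpr ⟨translH₄ A (0, u - u') c, translH₄_mem_orbSpan A ζ F _ hc, ?_⟩
  rw [Avec_translH₄_of_binVec A hA (u - u') e, sub_sub_cancel]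

/-- **Moved by `y`, off the mask.** [folklore] -/
theorem Y_mem (hA : Odd (Fintype.card A)) {F : Set (Ty₄ A → ℤ)} {j j' : Fin 4} {h h' g g' : Fin 4 → Bool} {u : A}
    (hb : bY ζ (σY j) = false) (ej : σY j = j') (e1 : qY ζ h = g) (e2 : qY ζ h' = g') (H : binVec A j h h' u ∈ valMod A ζ F) (u' : A) :
    binVec A j' g g' u' ∈ valMod A ζ F := by
  obtain ⟨c, hc, e⟩ := Submodule.mem_map.mp H
  have hy : Avec A (translY A ζ c) = binVec A j' g g' (-u) := by
    rw [Avec_translY_of_binVec A hA ζ e, hb]; simp only [Bool.false_eq_true, if_false, ej, e1, e2]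
  exact slot_mem A hA (Submodule.mem_map.mpr ⟨translY A ζ c, translY_mem_orbSpan A ζ F hc, hy⟩) u'

/-- **Moved by `y`, on the mask** (patterns complemented and swapped). [folklore] -/
theorem Y_mem' (hA : Odd (Fintype.card A)) {F : Set (Ty₄ A → ℤ)} {j j' : Fin 4} {h h' g g' : Fin 4 → Bool} {u : A}
    (hb : bY ζ (σY j) = true) (ej : σY j = j') (e1 : qY ζ (fun n => !h' n) = g) (e2 : qY ζ (fun n => !h n) = g')
    (H : binVec A j h h' u ∈ valMod A ζ F) (u' : A) : binVec A j' g g' u' ∈ valMod A ζ F := by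
  obtain ⟨c, hc, e⟩ := Submodule.mem_map.mp H
  have hy : Avec A (translY A ζ c) = binVec A j' g g' (-u) := by
    rw [Avec_translY_of_binVec A hA ζ e, hb]; simp only [if_true, ej, e1, e2]
  exact slot_mem A hA (Submodule.mem_map.mpr ⟨translY A ζ c, translY_mem_orbSpan A ζ F hc, hy⟩) u'

/-- **Moved by `t`, off the mask.** [folklore] -/
theorem T_mem (hA : Odd (Fintype.card A)) {F : Set (Ty₄ A → ℤ)} {j j' : Fin 4} {h h' g g' : Fin 4 → Bool} {u : A}
    (hb : bT (σT j) = false) (ej : σT j = j') (e1 : qT h = g) (e2 : qT h' = g') (H : binVec A j h h' u ∈ valMod A ζ F) (u' : A) :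
    binVec A j' g g' u' ∈ valMod A ζ F := by
  obtain ⟨c, hc, e⟩ := Submodule.mem_map.mp H
  have ht : Avec A (translT A c) = binVec A j' g g' u := by
    rw [Avec_translT_of_binVec A hA e, hb]; simp only [Bool.false_eq_true, if_false, ej, e1, e2]
  exact slot_mem A hA (Submodule.mem_map.mpr ⟨translT A c, translT_mem_orbSpan A ζ F hc, ht⟩) u'

/-- **Moved by `t`, on the mask.** [folklore] -/
theorem T_mem' (hA : Odd (Fintype.card A)) {F : Set (Ty₄ A → ℤ)} {j j' : Fin 4} {h h' g g' : Fin 4 → Bool} {u : A}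
    (hb : bT (σT j) = true) (ej : σT j = j') (e1 : qT (fun n => !h' n) = g) (e2 : qT (fun n => !h n) = g')
    (H : binVec A j h h' u ∈ valMod A ζ F) (u' : A) : binVec A j' g g' u' ∈ valMod A ζ F := by
  obtain ⟨c, hc, e⟩ := Submodule.mem_map.mp H
  have ht : Avec A (translT A c) = binVec A j' g g' u := by
    rw [Avec_translT_of_binVec A hA e, hb]; simp only [if_true, ej, e1, e2]
  exact slot_mem A hA (Submodule.mem_map.mpr ⟨translT A c, translT_mem_orbSpan A ζ F hc, ht⟩) u'

omit [Fintype A] [AddCommGroup A] in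
/-- **Chains.** [folklore] -/
theorem memT {M : Submodule ℤ (Idx A → ℤ)} {j : Fin 4} {a b c : Fin 4 → Bool} {u : A} (h1 : binVec A j a b u ∈ M)
    (h2 : binVec A j b c u ∈ M) : binVec A j a c u ∈ M := by
  have := M.add_mem h1 h2
  rwa [binVec_add_binVec] at this

omit [Fintype A] [AddCommGroup A] in
/-- **Reversal.** [folklore] -/
theorem memS {M : Submodule ℤ (Idx A → ℤ)} {j : Fin 4} {a b : Fin 4 → Bool} {u : A} (h : binVec A j a b u ∈ M) :
    binVec A j b a u ∈ M := by
  rw [binVec_swap]; exact M.neg_mem h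

omit [Fintype A] [AddCommGroup A] in
/-- **Free flips at the own coordinate**: patterns agreeing off `j` give the zero binomial. [folklore] -/
theorem memJ (M : Submodule ℤ (Idx A → ℤ)) {j : Fin 4} {a b : Fin 4 → Bool} (hab : ∀ n, n ≠ j → a n = b n) (u : A) :
    binVec A j a b u ∈ M := by
  rw [binVec_congr A (h₂ := b) (h₂' := b) hab (fun _ _ => rfl), binVec_self]; exact M.zero_mem

/-! ## §3 The two sources of binomials -/

omit [AddCommGroup A] in
/-- **The value vector of a mixed closing face is a slot binomial** (`|Q| = K`, `w ∉ Q`, `b i = true`, `i ≠ 0`). [folklore] -/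
theorem Avec_mixFace (hA : Odd (Fintype.card A)) (h3 : 3 ≤ Fintype.card A) {Q : Finset A} {w : A} (hw : w ∉ Q)
    (hQ : Q.card = Fintype.card A / 2) {i : Fin 4} (hi : i ≠ 0) (u : A) {b : Fin 4 → Bool} (hb : b i = true) :
    Avec A (mixFace A Q w i u b) =
      binVec A i (fun n => if n = 0 then false else !b n) (fun n => if n = 0 then true else !b n) u := by
  have key : ∀ (x : Bool) (η : Fin 4 → Bool), ind₁ i (fun n => if n = 0 then x else !b n) η =
      if η 0 = x ∧ ∀ n, n ≠ (0 : Fin 4) → n ≠ i → η n = !b n then 1 else 0 := by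
    intro x η
    unfold ind₁
    have e : (∀ n, n ≠ i → η n = (if n = 0 then x else !b n)) ↔ (η 0 = x ∧ ∀ n, n ≠ (0 : Fin 4) → n ≠ i → η n = !b n) := by
      constructor
      · intro H
        refine ⟨by simpa using H 0 hi.symm, fun n hn0 hni => ?_⟩
        have := H n hni; rw [if_neg hn0] at this; exact this
      · rintro ⟨H0, H⟩ n hni
        by_cases hn0 : n = 0
        · subst hn0; rw [if_pos rfl]; exact H0
        · rw [if_neg hn0]; exact H n hn0 hni
    simp only [e]
  funext idx
  rcases idx with ⟨j', η, s⟩ | η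
  · rw [Avec_inl, binVec_inl]
    by_cases hj : j' = i
    · subst hj
      rw [fnl_wA_mixFace_self A hA h3 hw hQ hi η s u hb, key, key]
      by_cases hs : s = u
      · simp only [hs, and_true, if_true]
      · simp only [hs, and_false, if_false, sub_self]
    · rw [fnl_wA_mixFace_of_ne A h3 hw hi hj, if_neg (fun H => hj H.1)]
  · rw [Avec_inr, binVec_inr, fnl_wC_mixFace A h3 hw hi]

/-- **Mixed faces of the family give binomials at every slot** (patterns supplied as literals via `e1`, `e2`). [folklore] -/
theorem mix_mem (hA : Odd (Fintype.card A)) (h3 : 3 ≤ Fintype.card A) {F : Set (Ty₄ A → ℤ)} {Q : Finset A} {w : A} (hw : w ∉ Q)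
    (hQ : Q.card = Fintype.card A / 2) {i : Fin 4} (hi : i ≠ 0) {u : A} {b : Fin 4 → Bool} (hb : b i = true)
    (hF : mixFace A Q w i u b ∈ F) {g g' : Fin 4 → Bool} (e1 : (fun n => if n = 0 then false else !b n) = g)
    (e2 : (fun n => if n = 0 then true else !b n) = g') (u' : A) : binVec A i g g' u' ∈ valMod A ζ F := by
  have h := Avec_mem_valMod A ζ F (subset_orbSpan A ζ F hF)
  rw [Avec_mixFace A hA h3 hw hQ hi u hb, e1, e2] at h
  exact slot_mem A hA h u'

/-- **The cross trick**: for a cross datum `(P⁺, σ, s₀)` the value vector of `S_b − (0,σ)·S_{!b}` is the antipodal binomial `binVec 0 (!b) b s₀`. [folklore] -/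
theorem Avec_cross (hA : Odd (Fintype.card A)) {P : Finset A} {u₁ u₂ : A} (h1 : u₁ ∉ P) (h2 : u₂ ∉ P) (h12 : u₁ ≠ u₂)
    (hP : P.card + 1 = Fintype.card A / 2) {σ s₀ : A} (hs₀ : s₀ ∈ insert u₁ (insert u₂ P))
    (hX : ∀ s, s + σ ∈ insert u₁ (insert u₂ P) ↔ (s ∉ insert u₁ (insert u₂ P) ∨ s = s₀)) (b : Fin 4 → Bool) :
    Avec A (sqFace A P u₁ u₂ b) - Avec A (translH₄ A (0, σ) (sqFace A P u₁ u₂ (fun n => !b n))) =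
      binVec A 0 (fun n => !b n) b s₀ := by
  funext idx
  rcases idx with ⟨j', η, s⟩ | η
  · rw [Pi.sub_apply, Avec_inl, Avec_inl, fnl_wA_translH₄ A hA, if_neg (fun e => zero_ne_one e), binVec_inl]
    by_cases hj : j' = 0
    · subst hj
      rw [fnl_wA_zero_sqFace A hA h1 h2 h12 hP, fnl_wA_zero_sqFace A hA h1 h2 h12 hP]
      simp only [Bool.not_not, true_and]
      have hXs := hX s
      by_cases hs : s = s₀
      · subst hs
        have hin : s + σ ∈ insert u₁ (insert u₂ P) := hXs.mpr (Or.inr rfl)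
        simp only [hs₀, hin, not_true_eq_false, and_false, and_true, if_false, if_true, zero_add]
        show _ = ind₁ 0 (fun n => !b n) η - ind₁ 0 b η
        unfold ind₁; rfl
      · rw [if_neg hs]
        by_cases hm : s ∈ insert u₁ (insert u₂ P)
        · have hout : s + σ ∉ insert u₁ (insert u₂ P) := fun H => by
            rcases hXs.mp H with H' | H'
            · exact H' hm
            · exact hs H'
          simp only [hm, hout, not_true_eq_false, not_false_eq_true, and_false, and_true, if_false, zero_add, add_zero, sub_self]
        · have hin : s + σ ∈ insert u₁ (insert u₂ P) := hXs.mpr (Or.inl hm)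
          simp only [hm, hin, not_true_eq_false, not_false_eq_true, and_false, and_true, if_false, zero_add, add_zero, sub_self]
    · rw [fnl_wA_ne_sqFace A hA hj η s h1 h2 h12, fnl_wA_ne_sqFace A hA hj η _ h1 h2 h12, if_neg (fun H => hj H.1), sub_self]
  · rw [Pi.sub_apply, Avec_inr, Avec_inr, fnl_wC_translH₄ A hA, if_neg (fun e => zero_ne_one e), binVec_inr,
      fnl_wC_sqFace A hA h1 h2 h12 hP, fnl_wC_sqFace A hA h1 h2 h12 hP]
    simp only [Bool.not_not]
    ring

/-- **The antipodal binomials of coordinate `0` at every slot**, from a complementary pair `S_b, S_{!b}` of the family and a cross datum. [folklore] -/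
theorem cross_mem (hA : Odd (Fintype.card A)) {F : Set (Ty₄ A → ℤ)} {P : Finset A} {u₁ u₂ : A} (h1 : u₁ ∉ P) (h2 : u₂ ∉ P)
    (h12 : u₁ ≠ u₂) (hP : P.card + 1 = Fintype.card A / 2) {σ s₀ : A} (hs₀ : s₀ ∈ insert u₁ (insert u₂ P))
    (hX : ∀ s, s + σ ∈ insert u₁ (insert u₂ P) ↔ (s ∉ insert u₁ (insert u₂ P) ∨ s = s₀)) {b : Fin 4 → Bool}
    (hb : sqFace A P u₁ u₂ b ∈ F) (hb' : sqFace A P u₁ u₂ (fun n => !b n) ∈ F) {g : Fin 4 → Bool} (e1 : (fun n => !b n) = g)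
    (u' : A) : binVec A 0 g b u' ∈ valMod A ζ F := by
  have hdiff : sqFace A P u₁ u₂ b - translH₄ A (0, σ) (sqFace A P u₁ u₂ (fun n => !b n)) ∈ orbSpan A ζ F :=
    Submodule.sub_mem _ (subset_orbSpan A ζ F hb) (translH₄_mem_orbSpan A ζ F _ (subset_orbSpan A ζ F hb'))
  have h := Avec_mem_valMod A ζ F hdiff
  rw [map_sub, Avec_cross A hA h1 h2 h12 hP hs₀ hX, e1] at h
  exact slot_mem A hA h u'

end

end Summit.HodgeConjecture.CorCM.Census.QuarticInversion
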